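import Mathlib
import Summits.Ventures.PercRepro.TriangleCapSubBandBound

/-!
# PercRepro — THE TOP OF EVERY SUB-BAND IS ATTAINED: THE SUB-BAND BOUND IS SHARP (p3, gen 52; part 261)

THE TOP WITNESS (`topWitness`): on `ℓ + 1 + (s − t)` vertices the `(t − u)`-star at the non-neighbour `1` with `e`
ends at non-leaves, plus `u` off-edges whose left ends run round-robin over `k` carriers `2, …, k + 1`
(`lfTop t u k = 1` on the star indices, `1 + lfRR k 0` shifted on the rest) and whose right ends are fresh
leaves: `attach = t − e`, `coll lf = (t − u)(t − u − 1) + coll u (lfRR k 0)` (THE CONCATENATION LEMMA `coll_concat`: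
collisions of a concatenation with disjoint images add), `coll rf = 0`, so
`2 j = 2 e + 2 u (t − u − 1) + u (u + 1) − (k q (q − 1) + 2 ρ q)`, `q = ⌊u / k⌋`, `ρ = u mod k`, for every
`e + k + 1 ≤ ℓ`.  With `k = ℓ − 1 ≤ u`, `e = 0`, the threshold identity of part 239 turns this into EQUALITY in the
sub-band bound of part 257 at `q = ⌊u / (ℓ − 1)⌋` (`subband_top_attained`); with `k = u ≤ ℓ − 1`, `e = ℓ − 1 − u`,
into equality at `q = 1` (`subband_top_attained_small`).  Axioms: standard.
-/

namespace PercRepro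

namespace TriangleCap

namespace C047

open Finset

/-- `coll` depends only on the values on `range t`. -/
theorem coll_congr (t : ℕ) (f g : ℕ → ℕ) (h : ∀ i, i < t → f i = g i) : coll t f = coll t g := by
  unfold coll
  apply congrArg
  apply filter_congr
  intro p hp
  rw [mem_offDiag, mem_range, mem_range] at hp
  rw [h p.1 hp.1, h p.2 hp.2.1]

/-- `coll` is invariant under adding a constant to the values. -/
theorem coll_add_const (t c : ℕ) (g : ℕ → ℕ) : coll t (fun i => c + g i) = coll t g := by
  unfold coll
  apply congrArg
  apply filter_congr
  intro p _
  show c + g p.1 = c + g p.2 ↔ g p.1 = g p.2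
  omega

/-- **THE CONCATENATION LEMMA:** the collision count of `f` on `range a` followed by `g` on `range b`, with disjoint
value sets, is `coll a f + coll b g`. -/
theorem coll_concat (a b : ℕ) (f g : ℕ → ℕ) (hdisj : ∀ i, i < a → ∀ i', i' < b → f i ≠ g i') :
    coll (a + b) (fun i => if i < a then f i else g (i - a)) = coll a f + coll b g := by
  unfold coll
  set S := (range (a + b)).offDiag.filter
    (fun p : ℕ × ℕ => (if p.1 < a then f p.1 else g (p.1 - a)) = (if p.2 < a then f p.2 else g (p.2 - a))) with hS
  have hsplit := card_filter_add_card_filter_not (s := S) (fun p : ℕ × ℕ => p.1 < a ∧ p.2 < a)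
  have h1 : S.filter (fun p : ℕ × ℕ => p.1 < a ∧ p.2 < a) =
      (range a).offDiag.filter (fun p : ℕ × ℕ => f p.1 = f p.2) := by
    ext ⟨i, i'⟩
    rw [hS]
    simp only [mem_filter, mem_offDiag, mem_range]
    constructor
    · rintro ⟨⟨⟨h1, h2, h3⟩, h4⟩, h5, h6⟩
      rw [if_pos h5, if_pos h6] at h4
      exact ⟨⟨h5, h6, h3⟩, h4⟩
    · rintro ⟨⟨h1, h2, h3⟩, h4⟩
      refine ⟨⟨⟨by omega, by omega, h3⟩, ?_⟩, h1, h2⟩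
      rw [if_pos h1, if_pos h2]
      exact h4
  have h2 : S.filter (fun p : ℕ × ℕ => ¬ (p.1 < a ∧ p.2 < a)) =
      ((range b).offDiag.filter (fun p : ℕ × ℕ => g p.1 = g p.2)).image (fun p => (p.1 + a, p.2 + a)) := by
    ext ⟨i, i'⟩
    rw [hS]
    simp only [mem_filter, mem_offDiag, mem_range, mem_image, Prod.mk.injEq, Prod.exists]
    constructor
    · rintro ⟨⟨⟨h1, h2, h3⟩, h4⟩, h5⟩
      have hi : a ≤ i := by
        by_contra hi
        rw [if_pos (by omega)] at h4
        by_cases hi' : i' < a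
        · exact h5 ⟨by omega, hi'⟩
        · rw [if_neg hi'] at h4
          exact hdisj i (by omega) (i' - a) (by omega) h4
      have hi' : a ≤ i' := by
        by_contra hi'
        rw [if_neg (by omega), if_pos (by omega)] at h4
        exact hdisj i' (by omega) (i - a) (by omega) h4.symm
      rw [if_neg (by omega), if_neg (by omega)] at h4
      exact ⟨i - a, i' - a, ⟨⟨by omega, by omega, by omega⟩, h4⟩, by omega, by omega⟩
    · rintro ⟨x, y, ⟨⟨h1, h2, h3⟩, h4⟩, rfl, rfl⟩
      refine ⟨⟨⟨by omega, by omega, by omega⟩, ?_⟩, by omega⟩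
      rw [if_neg (by omega), if_neg (by omega), Nat.add_sub_cancel, Nat.add_sub_cancel]
      exact h4
  rw [h1, h2, card_image_of_injective _ (fun p q h => by
    rw [Prod.mk.injEq] at h
    exact Prod.ext (by omega) (by omega))] at hsplit
  exact hsplit.symm

/-- The left ends of the top witness: `1` on the `t − u` star indices, the carriers `2, …, k + 1` round-robin on the
`u` others. -/
def lfTop (t u k i : ℕ) : ℕ := if i < t - u then 1 else 1 + lfRR k 0 (i - (t - u))

/-- `coll` of the top witness's left ends: `(t − u)(t − u − 1) + coll u (lfRR k 0)`. -/
theorem coll_lfTop (t u k : ℕ) (hu : u ≤ t) (hk : 1 ≤ k) :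
    coll t (lfTop t u k) = (t - u) * (t - u - 1) + coll u (lfRR k 0) := by
  have e : t = (t - u) + u := by omega
  have h := coll_concat (t - u) u (fun _ => 1) (fun i => 1 + lfRR k 0 i) (fun i _ i' _ => by
    have := lfRR_bounds k 0 i' hk
    omega)
  rw [coll_add_const] at h
  have hc : coll (t - u) (fun _ => 1) = (t - u) * (t - u - 1) := by
    rw [coll_congr (t - u) (fun _ => 1) (lfRR k (t - u)) (fun i hi => by unfold lfRR; rw [if_pos hi]),
      coll_lfRR_top]
  rw [← e, hc] at h
  exact h

/-- The right ends of the top witness: `e` non-leaves then leaves for the star, fresh leaves for the off-edges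
(`a = k + 2` is the left part). -/
def rfTop (s t k e i : ℕ) : ℕ :=
  if i < e then k + 2 + (s - t) + i else k + 2 + (i - e)

/-- **THE TOP WITNESS:** for `1 ≤ k`, `e + k + 1 ≤ ℓ`, `1 ≤ u`, `u + 1 ≤ t`, `2 t ≤ s`, the value
`2 j = 2 e + 2 u (t − u − 1) + u (u + 1) − coll u (lfRR k 0)` is attained on `ℓ + 1 + (s − t)` vertices
(`e ≤ t`; the star's non-leaf ends when `e ≤ t − u`). -/
theorem topWitness (ℓ s t u k e : ℕ) (hk : 1 ≤ k) (he : e + k + 1 ≤ ℓ) (het : e ≤ t) (hu : 1 ≤ u)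
    (hut : u + 1 ≤ t) (hs : 2 * t ≤ s) :
    ∃ (H : SimpleGraph (Fin (ℓ + 1 + (s - t)))) (_ : DecidableRel H.Adj), H.CliqueFree 3 ∧
      H.edgeFinset.card = s ∧ (∃ w, deg H w + t = s) ∧
      ∑ v, deg H v * deg H v + 2 * (t * (s - t - 1)) +
        (2 * e + 2 * (u * (t - u - 1)) + u * (u + 1) - coll u (lfRR k 0)) = s * (s + 1) := by
  set n := ℓ + 1 + (s - t) with hn
  have hn0 : 0 < n := by omega
  have hg : GoodEnds n (k + 2) t (lfTop t u k) (rfTop s t k e) := by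
    refine ⟨fun i hi => ?_, fun i hi => ?_, fun i i' hi hi' _ h2 => ?_⟩
    · unfold lfTop
      have := lfRR_bounds k 0 (i - (t - u)) hk
      split_ifs <;> omega
    · unfold rfTop
      split_ifs <;> omega
    · unfold rfTop at h2
      split_ifs at h2 <;> omega
  have hval := genWitness_missing_value n (k + 2) s t hn0 (lfTop t u k) (rfTop s t k e) hg (by omega) (by omega)
    (by omega) (by omega)
  have hatt : ((range t).filter (fun i => rfTop s t k e i < k + 2 + (s - t))).card = t - e := by
    have : (range t).filter (fun i => rfTop s t k e i < k + 2 + (s - t)) = Ico e t := by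
      ext i
      simp only [mem_filter, mem_range, mem_Ico]
      unfold rfTop
      split_ifs <;> omega
    rw [this, Nat.card_Ico]
  have hrf : coll t (rfTop s t k e) = 0 := by
    apply coll_eq_zero_of_injOn
    intro i i' hi hi' h
    unfold rfTop at h
    split_ifs at h <;> omega
  rw [hatt, hrf, coll_lfTop t u k (by omega) hk] at hval
  simp only [add_zero] at hval
  refine ⟨_, inferInstance, cliqueFree_of_bipSub _ _ (bipSub_missingGraph _ _),
    card_edges_missingGraph_genWitness n (k + 2) s t hn0 (lfTop t u k) (rfTop s t k e) hg (by omega) (by omega)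
      (by omega),
    ⟨fin' n hn0 0, by
      rw [deg_missingGraph_genWitness_zero n (k + 2) s t hn0 (lfTop t u k) (rfTop s t k e) hg (by omega)
        (by omega)]
      omega⟩, ?_⟩
  have e1 : t - (t - e) = e := by omega
  have hid := subband_identity t u hut
  have hcoll := coll_le u (lfRR k 0)
  have e2 : t * (t - 1) - ((t - u) * (t - u - 1) + coll u (lfRR k 0)) =
      2 * (u * (t - u - 1)) + u * (u + 1) - coll u (lfRR k 0) := by omega
  rw [e1, e2] at hval
  have e3 : 2 * e + 2 * (u * (t - u - 1)) + u * (u + 1) - coll u (lfRR k 0) =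
      2 * e + (2 * (u * (t - u - 1)) + u * (u + 1) - coll u (lfRR k 0)) := by
    have : u * (u - 1) ≤ u * (u + 1) := Nat.mul_le_mul_left u (by omega)
    omega
  rw [e3]
  exact hval

/-- **THE SUB-BAND BOUND IS SHARP (`u ≥ ℓ − 1`):** for `2 ≤ ℓ`, `ℓ ≤ u + 1`, `u + 1 ≤ t`, `2 t ≤ s`, the value
`2 j = 2 u (t − u − 1) + u (u + 1) − 2 q u + (ℓ − 1) q (q + 1)` with `q = ⌊u / (ℓ − 1)⌋` — equality in the sub-band
bound of part 257 — is attained on `ℓ + 1 + (s − t)` vertices. -/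
theorem subband_top_attained (ℓ s t u : ℕ) (hℓ : 2 ≤ ℓ) (hu : ℓ ≤ u + 1) (hut : u + 1 ≤ t) (hs : 2 * t ≤ s) :
    ∃ (H : SimpleGraph (Fin (ℓ + 1 + (s - t)))) (_ : DecidableRel H.Adj), H.CliqueFree 3 ∧
      H.edgeFinset.card = s ∧ (∃ w, deg H w + t = s) ∧
      ∑ v, deg H v * deg H v + 2 * (t * (s - t - 1)) +
        (2 * (u * (t - u - 1)) + u * (u + 1) + (ℓ - 1) * ((u / (ℓ - 1)) * (u / (ℓ - 1) + 1)) -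
          2 * (u / (ℓ - 1)) * u) = s * (s + 1) := by
  have h := topWitness ℓ s t u (ℓ - 1) 0 (by omega) (by omega) (by omega) (by omega) hut hs
  rw [coll_lfRR_zero (ℓ - 1) u (by omega)] at h
  have hth := row_threshold (ℓ - 1) u
  have e : 2 * 0 + 2 * (u * (t - u - 1)) + u * (u + 1) -
      ((ℓ - 1) * ((u / (ℓ - 1)) * (u / (ℓ - 1) - 1)) + 2 * ((u % (ℓ - 1)) * (u / (ℓ - 1)))) =
      2 * (u * (t - u - 1)) + u * (u + 1) + (ℓ - 1) * ((u / (ℓ - 1)) * (u / (ℓ - 1) + 1)) -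
        2 * (u / (ℓ - 1)) * u := by
    have hle : (ℓ - 1) * ((u / (ℓ - 1)) * (u / (ℓ - 1) - 1)) + 2 * ((u % (ℓ - 1)) * (u / (ℓ - 1))) ≤
        u * (u - 1) := by
      rw [← coll_lfRR_zero (ℓ - 1) u (by omega)]
      exact coll_le u _
    have : u * (u - 1) ≤ u * (u + 1) := Nat.mul_le_mul_left u (by omega)
    omega
  rw [e] at h
  exact h

/-- **THE SUB-BAND BOUND IS SHARP (`u ≤ ℓ − 1`):** for `1 ≤ u`, `u + 1 ≤ ℓ ≤ t + 1`, `u + 1 ≤ t`, `2 t ≤ s`, the value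
`2 j = 2 u (t − u − 1) + u (u + 1) − 2 u + 2 (ℓ − 1)` — equality in the sub-band bound at `q = 1` — is attained on
`ℓ + 1 + (s − t)` vertices. -/
theorem subband_top_attained_small (ℓ s t u : ℕ) (hu : 1 ≤ u) (hℓ : u + 1 ≤ ℓ) (hℓt : ℓ ≤ t + 1) (hut : u + 1 ≤ t)
    (hs : 2 * t ≤ s) :
    ∃ (H : SimpleGraph (Fin (ℓ + 1 + (s - t)))) (_ : DecidableRel H.Adj), H.CliqueFree 3 ∧
      H.edgeFinset.card = s ∧ (∃ w, deg H w + t = s) ∧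
      ∑ v, deg H v * deg H v + 2 * (t * (s - t - 1)) +
        (2 * (u * (t - u - 1)) + u * (u + 1) + 2 * (ℓ - 1) - 2 * u) = s * (s + 1) := by
  have h := topWitness ℓ s t u u (ℓ - 1 - u) hu (by omega) (by omega) hu hut hs
  rw [coll_lfRR_zero u u hu, Nat.div_self hu, Nat.mod_self] at h
  have e : 2 * (ℓ - 1 - u) + 2 * (u * (t - u - 1)) + u * (u + 1) - (u * (1 * (1 - 1)) + 2 * (0 * 1)) =
      2 * (u * (t - u - 1)) + u * (u + 1) + 2 * (ℓ - 1) - 2 * u := by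
    simp only [Nat.sub_self, mul_zero, zero_mul, add_zero, Nat.sub_zero]
    omega
  rw [e] at h
  exact h

end C047

end TriangleCap

end PercRepro
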